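import Literature.NumberTheory.ComplexMultiplication.CMTypeSubfieldTracesReflexFieldDegree
import HarnessLib

/-!
# The Galois class of a CM type is partitioned by the `k₀`-signature into `[ℚ(tr_Φ(k₀)) : ℚ]` blocks of equal size
# `[K* : ℚ(tr_Φ(k₀))]`; a block is the `Aut(ℂ/ℚ(tr_Φ(k₀)))`-orbit (Dodson: «`G*(f) = G₀*(f) ∪ G₀*(ρf)`»)

Layer `Literature/NumberTheory/ComplexMultiplication`, namespace `Literature.NumberTheory.ComplexMultiplication` (lane
`lit-hodgefound`, Track 2 foundations, Layer A3; seat `lit-hodgefound-p11`, generation 29, row g29-#8).  Sequel of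
`CMTypeSubfieldTracesReflexFieldDegree` (g29-#6: the `k₀`-signatures met in the Galois class of `Φ` number
`[ℚ(tr_Φ(k₀)) : ℚ]`), `CMTypeGaloisClassReflexDegree` (g24-#6: the class has `[K* : ℚ]` members), `CMTypeSubfieldTracesReflexField`
(g28-#5: `Aut(ℂ/ℚ(tr_Φ(k₀))) = Stab(m)`) and `CMTypeSignatureGaloisClasses` (g26-#2: `m_{τΦ} = τ·m_Φ`).  THEOREMS ONLY (D-0026):
no definition, no named fact, no instance; the block of `Φ` is WRITTEN OUT as the subtype
`{Ψ // (∃ τ, Ψ = τΦ) ∧ m_Ψ = m_Φ}` with `m_Ψ = fun ψ => {φ : K →+* ℂ | φ ∈ Ψ.1 ∧ φ.comp (algebraMap k₀ K) = ψ}.ncard`.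

THE PRINTS.  B. Dodson, *The structure of Galois groups of CM-fields*, Trans. AMS 283 (1984) [Dodson1984] §1.1 Remark (held
`paper:doi-10-2307-1999987` p. 5: «`[K′ : ℚ]` is also the order of the orbit of `Φ` under the `G`-action») and §3.1.1
Theorem, proof (p. 12), for an imaginary quadratic subfield `D ⊂ K` with `G₀ = Gal(K₀ᶜ/ℚ)`-part of the orbit: «so that the
`G`-orbit of `f` is `G₀*(f) ∪ G₀*(ρf)` […] the weight `w = weight(v)` is constant for `v ∈ G₀*(f)`» — the orbit splits into
the blocks of constant signature, permuted transitively (`ρ` swaps them), hence of equal size.  In general: the class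
`Aut(ℂ)·Φ` maps `Aut(ℂ)`-equivariantly ONTO the conjugates `τ·m` of the `k₀`-signature `m` (`[ℚ(tr_Φ(k₀)) : ℚ]` of them,
Kottwitz's reflex field of `m` [Kottwitz1992] §5 pp. 389–390 and Milne–Shih [Deligne1982HodgeCycles] V §1 p. 216), the fibre
over `m` is the orbit of `Φ` under `Stab(m) = Aut(ℂ/ℚ(tr_Φ(k₀)))`, of size `[K* : ℚ(tr_Φ(k₀))]` (G. Shimura [Shimura1998]
§8.3 Prop. 28: `[K* : ℚ] = [G : H*]`; J. S. Milne [MilneFT2022] Prop. 1.20 tower law, Cor. 3.4).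

WHAT IS PROVED (`K` a CM field, `k₀ : IntermediateField ℚ K`, `Φ : CMType K`, `E₀ = ℚ(tr_Φ(k₀))`, `K* = traceField Φ`).
§1 `natCard_block_cmTypeSmul_eq` (the blocks of `σΦ` and `Φ` are equinumerous: `Ψ ↦ σΨ`),
   **`natCard_galoisClass_eq_natCard_signatures_mul_natCard_block`** (`#(Aut(ℂ)·Φ) = #{τ·m} · #block`),
   **`natCard_block_mul_finrank_eq_finrank_traceField`** (`#block · [E₀ : ℚ] = [K* : ℚ]`), `natCard_block_eq_finrank_div`,
   **`natCard_block_eq_relfinrank`** (`#block = [K* : E₀]`), `natCard_block_dvd_finrank_traceField`.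
§2 **`natCard_block_eq_natCard_orbit_fixing`** (THE BLOCK IS THE `Aut(ℂ/E₀)`-ORBIT: `#{τΦ ∣ τ|_{E₀} = id} = [K* : E₀]`,
   `natCard_orbit_fixing_eq_relfinrank`), `natCard_block_eq_one_iff` (**`Φ` IS DETERMINED INSIDE ITS GALOIS CLASS BY ITS
   `k₀`-SIGNATURE ⟺ `ℚ(tr_Φ(k₀)) = K*`**), `natCard_block_eq_natCard_galoisClass_iff` (one block ⟺ `E₀ = ℚ` ⟺ balanced).
§3 `k₀` imaginary quadratic: `two_mul_natCard_block_eq_of_ncard_ne` (Dodson's `|G₀*(f)| = |G*(f)|/2` when `m_{ψ₀} ≠ m_{ψ̄₀}`),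
   `natCard_block_eq_of_ncard_eq` (balanced: the block is the class).

## References

* [Dodson1984] B. Dodson, *The structure of Galois groups of CM-fields*, Trans. AMS 283 (1984), §1.1 Remark (p. 5), §3.1.1
  Theorem and proof (p. 12).
* [Kottwitz1992] R. E. Kottwitz, *Points on some Shimura varieties over finite fields*, JAMS 5 (1992), §5 pp. 389–390.
* [Deligne1982HodgeCycles] P. Deligne, J. S. Milne, A. Ogus, K.-y. Shih, LNM 900 (1982): J. S. Milne, K.-y. Shih, V §1 p. 216.
* [Shimura1998] G. Shimura, *Abelian Varieties with Complex Multiplication and Modular Functions* (1998), §8.3 Prop. 28.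
* [MilneFT2022] J. S. Milne, *Fields and Galois Theory* (2022), Prop. 1.20, Prop. 2.7, Cor. 3.4.

## Provenance

Lane `lit-hodgefound` (HOME `run/shared/lean/pub/lit-hodgefound/`), prover seat `lit-hodgefound-p11` (gen 29), self-proposed row
g29-#8 (lane INBOX claim 2026-08-27), sequel of g29-#6 / g28-#5 / g26-#2 / g24-#6.
-/

set_option autoImplicit false

noncomputable section

open scoped Classical Pointwise
open NumberField Module IntermediateField

namespace Literature.NumberTheory.ComplexMultiplication

open Literature.AlgebraicGeometry.Motives (CMType)
open Literature.AlgebraicGeometry.Motives.HodgeStructure (cmTypeSmul cmTypeSmul_val)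

variable {K : Type} [Field K] [NumberField K] [IsCMField K] (k₀ : IntermediateField ℚ K) (Φ : CMType K)

/-! ## §0 Preliminaries -/

section Prelim

/-- The Galois class of a CM type is finite (it has `[K* : ℚ]` members). [folklore] -/
private theorem finite_galoisClass_sb : Finite {Ψ : CMType K // ∃ τ : ℂ ≃+* ℂ, Ψ = cmTypeSmul τ Φ} :=
  Nat.finite_of_card_ne_zero (by rw [natCard_galoisClass_eq_finrank_traceField]; exact (finrank_traceField_pos Φ).ne')

/-- `m_{σΨ} = σ·m_Ψ` as functions. [folklore] -/
private theorem signature_cmTypeSmul_sb (σ : ℂ ≃+* ℂ) (Ψ : CMType K) :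
    (fun ψ : k₀ →+* ℂ => {φ : K →+* ℂ | φ ∈ (cmTypeSmul σ Ψ).1 ∧ φ.comp (algebraMap k₀ K) = ψ}.ncard) =
      fun ψ => {φ : K →+* ℂ | φ ∈ Ψ.1 ∧ φ.comp (algebraMap k₀ K) = σ⁻¹ • ψ}.ncard :=
  funext fun ψ => ncard_inter_fibre_cmTypeSmul k₀ σ Ψ ψ

/-- `m_{σΨ} = m_{σΨ′} ⟺ m_Ψ = m_{Ψ′}`. [folklore] -/
private theorem signature_cmTypeSmul_eq_iff_sb (σ : ℂ ≃+* ℂ) (Ψ Ψ' : CMType K) :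
    (fun ψ : k₀ →+* ℂ => {φ : K →+* ℂ | φ ∈ (cmTypeSmul σ Ψ).1 ∧ φ.comp (algebraMap k₀ K) = ψ}.ncard) =
        (fun ψ => {φ : K →+* ℂ | φ ∈ (cmTypeSmul σ Ψ').1 ∧ φ.comp (algebraMap k₀ K) = ψ}.ncard) ↔
      (fun ψ : k₀ →+* ℂ => {φ : K →+* ℂ | φ ∈ Ψ.1 ∧ φ.comp (algebraMap k₀ K) = ψ}.ncard) =
        fun ψ => {φ : K →+* ℂ | φ ∈ Ψ'.1 ∧ φ.comp (algebraMap k₀ K) = ψ}.ncard := by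
  rw [signature_cmTypeSmul_sb, signature_cmTypeSmul_sb]
  constructor
  · intro h
    funext ψ
    have h1 := congr_fun h (σ • ψ)
    simp only [inv_smul_smul] at h1
    exact h1
  · intro h
    funext ψ
    exact congr_fun h (σ⁻¹ • ψ)

end Prelim

/-! ## §1 The class is partitioned into `[ℚ(tr_Φ(k₀)) : ℚ]` blocks of equal size `[K* : ℚ(tr_Φ(k₀))]` -/

section Blocks

/-- **The block of `σΦ` (conjugates of `Φ` with the `k₀`-signature of `σΦ`) is equinumerous with the block of `Φ`** (`Ψ ↦ σΨ`;
Dodson: `G₀*(f)` and `G₀*(ρf) = ρ·G₀*(f)`). [cite: Dodson1984, §3.1.1 Theorem (proof, p. 12)] -/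
theorem natCard_block_cmTypeSmul_eq (σ : ℂ ≃+* ℂ) :
    Nat.card {Ψ : CMType K // (∃ τ : ℂ ≃+* ℂ, Ψ = cmTypeSmul τ Φ) ∧
        (fun ψ : k₀ →+* ℂ => {φ : K →+* ℂ | φ ∈ Ψ.1 ∧ φ.comp (algebraMap k₀ K) = ψ}.ncard) =
          fun ψ => {φ : K →+* ℂ | φ ∈ (cmTypeSmul σ Φ).1 ∧ φ.comp (algebraMap k₀ K) = ψ}.ncard} =
      Nat.card {Ψ : CMType K // (∃ τ : ℂ ≃+* ℂ, Ψ = cmTypeSmul τ Φ) ∧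
        (fun ψ : k₀ →+* ℂ => {φ : K →+* ℂ | φ ∈ Ψ.1 ∧ φ.comp (algebraMap k₀ K) = ψ}.ncard) =
          fun ψ => {φ : K →+* ℂ | φ ∈ Φ.1 ∧ φ.comp (algebraMap k₀ K) = ψ}.ncard} := by
  refine Nat.card_congr
    { toFun := fun Ψ => ⟨cmTypeSmul σ⁻¹ Ψ.1, ?_, ?_⟩
      invFun := fun Ψ => ⟨cmTypeSmul σ Ψ.1, ?_, ?_⟩
      left_inv := fun Ψ => Subtype.ext (cmTypeSmul_cmTypeSmul_inv σ Ψ.1)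
      right_inv := fun Ψ => Subtype.ext (cmTypeSmul_inv_cmTypeSmul σ Ψ.1) }
  · obtain ⟨τ, hτ⟩ := Ψ.2.1
    exact ⟨σ⁻¹ * τ, by rw [hτ, cmTypeSmul_mul]⟩
  · rw [← signature_cmTypeSmul_eq_iff_sb k₀ σ, cmTypeSmul_cmTypeSmul_inv]
    exact Ψ.2.2
  · obtain ⟨τ, hτ⟩ := Ψ.2.1
    exact ⟨σ * τ, by rw [hτ, cmTypeSmul_mul]⟩
  · rw [signature_cmTypeSmul_eq_iff_sb k₀ σ]
    exact Ψ.2.2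

/-- **`#(Aut(ℂ)·Φ) = #{τ·m} · #block`**: the Galois class of `Φ` maps onto the conjugates of its `k₀`-signature with
equinumerous fibres (the blocks). [cite: Dodson1984, §3.1.1 Theorem (proof, p. 12)] [cite: MilneFT2022, Prop. 1.20] -/
theorem natCard_galoisClass_eq_natCard_signatures_mul_natCard_block :
    Nat.card {Ψ : CMType K // ∃ τ : ℂ ≃+* ℂ, Ψ = cmTypeSmul τ Φ} =
      Nat.card {m : (k₀ →+* ℂ) → ℕ // ∃ τ : ℂ ≃+* ℂ,
          m = fun ψ => {φ : K →+* ℂ | φ ∈ (cmTypeSmul τ Φ).1 ∧ φ.comp (algebraMap k₀ K) = ψ}.ncard} *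
        Nat.card {Ψ : CMType K // (∃ τ : ℂ ≃+* ℂ, Ψ = cmTypeSmul τ Φ) ∧
          (fun ψ : k₀ →+* ℂ => {φ : K →+* ℂ | φ ∈ Ψ.1 ∧ φ.comp (algebraMap k₀ K) = ψ}.ncard) =
            fun ψ => {φ : K →+* ℂ | φ ∈ Φ.1 ∧ φ.comp (algebraMap k₀ K) = ψ}.ncard} := by
  haveI := finite_galoisClass_sb Φ
  -- the signature map from the class onto the conjugate signatures
  let f : {Ψ : CMType K // ∃ τ : ℂ ≃+* ℂ, Ψ = cmTypeSmul τ Φ} →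
      {m : (k₀ →+* ℂ) → ℕ // ∃ τ : ℂ ≃+* ℂ,
        m = fun ψ => {φ : K →+* ℂ | φ ∈ (cmTypeSmul τ Φ).1 ∧ φ.comp (algebraMap k₀ K) = ψ}.ncard} :=
    fun Ψ => ⟨fun ψ => {φ : K →+* ℂ | φ ∈ Ψ.1.1 ∧ φ.comp (algebraMap k₀ K) = ψ}.ncard,
      Ψ.2.choose, by rw [← Ψ.2.choose_spec]⟩
  have hf : Function.Surjective f := by
    rintro ⟨m, τ, rfl⟩
    exact ⟨⟨cmTypeSmul τ Φ, τ, rfl⟩, rfl⟩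
  haveI : Finite {m : (k₀ →+* ℂ) → ℕ // ∃ τ : ℂ ≃+* ℂ,
      m = fun ψ => {φ : K →+* ℂ | φ ∈ (cmTypeSmul τ Φ).1 ∧ φ.comp (algebraMap k₀ K) = ψ}.ncard} :=
    Finite.of_surjective f hf
  letI : Fintype {m : (k₀ →+* ℂ) → ℕ // ∃ τ : ℂ ≃+* ℂ,
      m = fun ψ => {φ : K →+* ℂ | φ ∈ (cmTypeSmul τ Φ).1 ∧ φ.comp (algebraMap k₀ K) = ψ}.ncard} := Fintype.ofFinite _
  -- every fibre is a block, and all blocks are equinumerous with the block of `Φ`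
  have hfib : ∀ t, Nat.card {Ψ // f Ψ = t} =
      Nat.card {Ψ : CMType K // (∃ τ : ℂ ≃+* ℂ, Ψ = cmTypeSmul τ Φ) ∧
        (fun ψ : k₀ →+* ℂ => {φ : K →+* ℂ | φ ∈ Ψ.1 ∧ φ.comp (algebraMap k₀ K) = ψ}.ncard) =
          fun ψ => {φ : K →+* ℂ | φ ∈ Φ.1 ∧ φ.comp (algebraMap k₀ K) = ψ}.ncard} := by
    rintro ⟨m, σ, rfl⟩
    rw [← natCard_block_cmTypeSmul_eq k₀ Φ σ]
    refine Nat.card_congr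
      { toFun := fun Ψ => ⟨Ψ.1.1, Ψ.1.2, ?_⟩
        invFun := fun Ψ => ⟨⟨Ψ.1, Ψ.2.1⟩, ?_⟩
        left_inv := fun _ => rfl
        right_inv := fun _ => rfl }
    · exact congrArg Subtype.val Ψ.2
    · exact Subtype.ext Ψ.2.2
  rw [← Nat.card_congr (Equiv.sigmaFiberEquiv f), Nat.card_sigma, Finset.sum_congr rfl fun t _ => hfib t,
    Finset.sum_const, Finset.card_univ, smul_eq_mul, ← Nat.card_eq_fintype_card]

/-- **`#block · [ℚ(tr_Φ(k₀)) : ℚ] = [K* : ℚ]`** (`#(Aut(ℂ)·Φ) = [K* : ℚ]`, g24-#6; `#{τ·m} = [ℚ(tr_Φ(k₀)) : ℚ]`, g29-#6).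
[cite: Dodson1984, §1.1 Remark (p. 5) and §3.1.1 Theorem (proof, p. 12)] [cite: Shimura1998, §8.3 Prop. 28] -/
theorem natCard_block_mul_finrank_eq_finrank_traceField :
    Nat.card {Ψ : CMType K // (∃ τ : ℂ ≃+* ℂ, Ψ = cmTypeSmul τ Φ) ∧
        (fun ψ : k₀ →+* ℂ => {φ : K →+* ℂ | φ ∈ Ψ.1 ∧ φ.comp (algebraMap k₀ K) = ψ}.ncard) =
          fun ψ => {φ : K →+* ℂ | φ ∈ Φ.1 ∧ φ.comp (algebraMap k₀ K) = ψ}.ncard} *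
      finrank ℚ (IntermediateField.adjoin ℚ (Set.range fun a : k₀ => cmTypeTrace Φ (algebraMap k₀ K a))) =
        finrank ℚ (traceField Φ) := by
  rw [← natCard_subfieldSignature_cmTypeSmul_eq_finrank k₀ Φ, mul_comm, ← natCard_galoisClass_eq_natCard_signatures_mul_natCard_block,
    natCard_galoisClass_eq_finrank_traceField]

/-- `#block = [K* : ℚ] / [ℚ(tr_Φ(k₀)) : ℚ]`. [cite: Dodson1984, §3.1.1 Theorem (proof, p. 12)] [cite: MilneFT2022, Prop. 1.20] -/
theorem natCard_block_eq_finrank_div :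
    Nat.card {Ψ : CMType K // (∃ τ : ℂ ≃+* ℂ, Ψ = cmTypeSmul τ Φ) ∧
        (fun ψ : k₀ →+* ℂ => {φ : K →+* ℂ | φ ∈ Ψ.1 ∧ φ.comp (algebraMap k₀ K) = ψ}.ncard) =
          fun ψ => {φ : K →+* ℂ | φ ∈ Φ.1 ∧ φ.comp (algebraMap k₀ K) = ψ}.ncard} =
      finrank ℚ (traceField Φ) /
        finrank ℚ (IntermediateField.adjoin ℚ (Set.range fun a : k₀ => cmTypeTrace Φ (algebraMap k₀ K a))) := by
  haveI := finiteDimensional_adjoin_cmTypeTrace_algebraMap k₀ Φ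
  rw [← natCard_block_mul_finrank_eq_finrank_traceField k₀ Φ, Nat.mul_div_cancel _ Module.finrank_pos]

/-- **`#block = [K* : ℚ(tr_Φ(k₀))]`** (the relative degree, `IntermediateField.relfinrank`; tower law
`[ℚ(tr_Φ(k₀)) : ℚ] · [K* : ℚ(tr_Φ(k₀))] = [K* : ℚ]`). [cite: MilneFT2022, Prop. 1.20] [cite: Shimura1998, §8.3 Prop. 28]
[cite: Dodson1984, §3.1.1 Theorem (proof, p. 12)] -/
theorem natCard_block_eq_relfinrank :
    Nat.card {Ψ : CMType K // (∃ τ : ℂ ≃+* ℂ, Ψ = cmTypeSmul τ Φ) ∧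
        (fun ψ : k₀ →+* ℂ => {φ : K →+* ℂ | φ ∈ Ψ.1 ∧ φ.comp (algebraMap k₀ K) = ψ}.ncard) =
          fun ψ => {φ : K →+* ℂ | φ ∈ Φ.1 ∧ φ.comp (algebraMap k₀ K) = ψ}.ncard} =
      IntermediateField.relfinrank (IntermediateField.adjoin ℚ (Set.range fun a : k₀ => cmTypeTrace Φ (algebraMap k₀ K a)))
        (traceField Φ) := by
  haveI := finiteDimensional_adjoin_cmTypeTrace_algebraMap k₀ Φ
  have h1 := natCard_block_mul_finrank_eq_finrank_traceField k₀ Φ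
  have h2 := IntermediateField.finrank_bot_mul_relfinrank (adjoin_cmTypeTrace_algebraMap_le_traceField k₀ Φ)
  rw [mul_comm] at h1
  exact Nat.eq_of_mul_eq_mul_left Module.finrank_pos (h1.trans h2.symm)

/-- `#block ∣ [K* : ℚ]`. [cite: Dodson1984, §3.1.1 Theorem (proof, p. 12)] -/
theorem natCard_block_dvd_finrank_traceField :
    Nat.card {Ψ : CMType K // (∃ τ : ℂ ≃+* ℂ, Ψ = cmTypeSmul τ Φ) ∧
        (fun ψ : k₀ →+* ℂ => {φ : K →+* ℂ | φ ∈ Ψ.1 ∧ φ.comp (algebraMap k₀ K) = ψ}.ncard) =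
          fun ψ => {φ : K →+* ℂ | φ ∈ Φ.1 ∧ φ.comp (algebraMap k₀ K) = ψ}.ncard} ∣ finrank ℚ (traceField Φ) :=
  Dvd.intro _ (natCard_block_mul_finrank_eq_finrank_traceField k₀ Φ)

end Blocks

/-! ## §2 The block of `Φ` is its `Aut(ℂ/ℚ(tr_Φ(k₀)))`-orbit; when it is a singleton / the whole class -/

section Orbit

/-- **THE BLOCK IS THE `Aut(ℂ/ℚ(tr_Φ(k₀)))`-ORBIT**: a conjugate `τΦ` has the `k₀`-signature of `Φ` iff it is `τ′Φ` for some `τ′`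
fixing `ℚ(tr_Φ(k₀))` pointwise (`Aut(ℂ/ℚ(tr_Φ(k₀))) = Stab(m)`, g28-#5; take `τ′ = τ`). [cite: Kottwitz1992, §5 pp. 389–390]
[cite: Dodson1984, §3.1.1 Theorem (proof, p. 12)] -/
theorem natCard_block_eq_natCard_orbit_fixing :
    Nat.card {Ψ : CMType K // (∃ τ : ℂ ≃+* ℂ, Ψ = cmTypeSmul τ Φ) ∧
        (fun ψ : k₀ →+* ℂ => {φ : K →+* ℂ | φ ∈ Ψ.1 ∧ φ.comp (algebraMap k₀ K) = ψ}.ncard) =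
          fun ψ => {φ : K →+* ℂ | φ ∈ Φ.1 ∧ φ.comp (algebraMap k₀ K) = ψ}.ncard} =
      Nat.card {Ψ : CMType K // ∃ τ : ℂ ≃+* ℂ,
        (∀ z : ℂ, z ∈ IntermediateField.adjoin ℚ (Set.range fun a : k₀ => cmTypeTrace Φ (algebraMap k₀ K a)) → τ z = z) ∧
          Ψ = cmTypeSmul τ Φ} := by
  -- `m_{τΦ} = m_Φ ⟺ τ ∈ Stab(m) ⟺ τ` fixes `ℚ(tr_Φ(k₀))`
  have key : ∀ τ : ℂ ≃+* ℂ,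
      ((fun ψ : k₀ →+* ℂ => {φ : K →+* ℂ | φ ∈ (cmTypeSmul τ Φ).1 ∧ φ.comp (algebraMap k₀ K) = ψ}.ncard) =
          fun ψ => {φ : K →+* ℂ | φ ∈ Φ.1 ∧ φ.comp (algebraMap k₀ K) = ψ}.ncard) ↔
        ∀ z : ℂ, z ∈ IntermediateField.adjoin ℚ (Set.range fun a : k₀ => cmTypeTrace Φ (algebraMap k₀ K a)) → τ z = z := by
    intro τ
    rw [forall_mem_adjoin_cmTypeTrace_algebraMap_iff, signature_cmTypeSmul_sb]
    constructor
    · intro h ψ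
      have h1 := congr_fun h (τ • ψ)
      simp only [inv_smul_smul] at h1
      exact h1.symm
    · intro h
      funext ψ
      have h1 := h (τ⁻¹ • ψ)
      rw [smul_inv_smul] at h1
      exact h1.symm
  refine Nat.card_congr (Equiv.subtypeEquivRight fun Ψ => ⟨?_, ?_⟩)
  · rintro ⟨⟨τ, rfl⟩, hm⟩
    exact ⟨τ, (key τ).1 hm, rfl⟩
  · rintro ⟨τ, hτ, rfl⟩
    exact ⟨⟨τ, rfl⟩, (key τ).2 hτ⟩

/-- **`#{τΦ ∣ τ ∈ Aut(ℂ/ℚ(tr_Φ(k₀)))} = [K* : ℚ(tr_Φ(k₀))]`**: the conjugates of `Φ` over the subfield trace field number the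
relative degree of the reflex field over it (the relative form of «`[K′ : ℚ]` is the order of the orbit of `Φ`»).
[cite: Dodson1984, §1.1 Remark (p. 5)] [cite: Shimura1998, §8.3 Prop. 28] [cite: MilneFT2022, Cor. 3.4] -/
theorem natCard_orbit_fixing_eq_relfinrank :
    Nat.card {Ψ : CMType K // ∃ τ : ℂ ≃+* ℂ,
        (∀ z : ℂ, z ∈ IntermediateField.adjoin ℚ (Set.range fun a : k₀ => cmTypeTrace Φ (algebraMap k₀ K a)) → τ z = z) ∧
          Ψ = cmTypeSmul τ Φ} =
      IntermediateField.relfinrank (IntermediateField.adjoin ℚ (Set.range fun a : k₀ => cmTypeTrace Φ (algebraMap k₀ K a)))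
        (traceField Φ) := by
  rw [← natCard_block_eq_natCard_orbit_fixing, natCard_block_eq_relfinrank]

/-- **`Φ` IS THE ONLY TYPE OF ITS GALOIS CLASS WITH ITS `k₀`-SIGNATURE ⟺ `ℚ(tr_Φ(k₀)) = K*`** (block of size one ⟺ relative
degree one). [cite: Dodson1984, §3.1.1 Theorem (proof, p. 12)] [cite: Shimura1998, §8.3 Prop. 28] -/
theorem natCard_block_eq_one_iff :
    Nat.card {Ψ : CMType K // (∃ τ : ℂ ≃+* ℂ, Ψ = cmTypeSmul τ Φ) ∧
        (fun ψ : k₀ →+* ℂ => {φ : K →+* ℂ | φ ∈ Ψ.1 ∧ φ.comp (algebraMap k₀ K) = ψ}.ncard) =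
          fun ψ => {φ : K →+* ℂ | φ ∈ Φ.1 ∧ φ.comp (algebraMap k₀ K) = ψ}.ncard} = 1 ↔
      IntermediateField.adjoin ℚ (Set.range fun a : k₀ => cmTypeTrace Φ (algebraMap k₀ K a)) = traceField Φ := by
  rw [natCard_block_eq_relfinrank, IntermediateField.relfinrank_eq_one_iff]
  exact ⟨fun h => le_antisymm (adjoin_cmTypeTrace_algebraMap_le_traceField k₀ Φ) h, fun h => h.ge⟩

/-- `ℚ(tr_Φ(k₀)) = K*` ⟹ a conjugate of `Φ` with the `k₀`-signature of `Φ` IS `Φ`. [cite: Dodson1984, §3.1.1 Theorem (proof, p. 12)]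
[cite: Kottwitz1992, §5 pp. 389–390] -/
theorem cmTypeSmul_eq_self_of_signature_eq_of_adjoin_eq_traceField
    (h : IntermediateField.adjoin ℚ (Set.range fun a : k₀ => cmTypeTrace Φ (algebraMap k₀ K a)) = traceField Φ)
    {τ : ℂ ≃+* ℂ} (hm : (fun ψ : k₀ →+* ℂ => {φ : K →+* ℂ | φ ∈ (cmTypeSmul τ Φ).1 ∧ φ.comp (algebraMap k₀ K) = ψ}.ncard) =
      fun ψ => {φ : K →+* ℂ | φ ∈ Φ.1 ∧ φ.comp (algebraMap k₀ K) = ψ}.ncard) :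
    cmTypeSmul τ Φ = Φ := by
  haveI := finite_galoisClass_sb Φ
  have h1 := (natCard_block_eq_one_iff k₀ Φ).2 h
  haveI : Finite {Ψ : CMType K // (∃ τ : ℂ ≃+* ℂ, Ψ = cmTypeSmul τ Φ) ∧
      (fun ψ : k₀ →+* ℂ => {φ : K →+* ℂ | φ ∈ Ψ.1 ∧ φ.comp (algebraMap k₀ K) = ψ}.ncard) =
        fun ψ => {φ : K →+* ℂ | φ ∈ Φ.1 ∧ φ.comp (algebraMap k₀ K) = ψ}.ncard} := Nat.finite_of_card_ne_zero (by omega)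
  have hsub := (Nat.card_eq_one_iff_unique.1 h1).1
  have := @Subsingleton.elim _ hsub ⟨cmTypeSmul τ Φ, ⟨τ, rfl⟩, hm⟩ ⟨Φ, ⟨1, (cmTypeSmul_one Φ).symm⟩, rfl⟩
  exact congrArg Subtype.val this

/-- **ONE block (the block of `Φ` is the whole class) ⟺ `ℚ(tr_Φ(k₀)) = ℚ`** ⟺ `Φ` balanced over `k₀` (g29-#3).
[cite: Dodson1984, §3.1.1 Theorem (proof, p. 12)] [cite: Kottwitz1992, §5 pp. 389–390] -/
theorem natCard_block_eq_natCard_galoisClass_iff :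
    Nat.card {Ψ : CMType K // (∃ τ : ℂ ≃+* ℂ, Ψ = cmTypeSmul τ Φ) ∧
        (fun ψ : k₀ →+* ℂ => {φ : K →+* ℂ | φ ∈ Ψ.1 ∧ φ.comp (algebraMap k₀ K) = ψ}.ncard) =
          fun ψ => {φ : K →+* ℂ | φ ∈ Φ.1 ∧ φ.comp (algebraMap k₀ K) = ψ}.ncard} =
        Nat.card {Ψ : CMType K // ∃ τ : ℂ ≃+* ℂ, Ψ = cmTypeSmul τ Φ} ↔
      IntermediateField.adjoin ℚ (Set.range fun a : k₀ => cmTypeTrace Φ (algebraMap k₀ K a)) = ⊥ := by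
  haveI := finiteDimensional_adjoin_cmTypeTrace_algebraMap k₀ Φ
  rw [← IntermediateField.finrank_eq_one_iff, natCard_galoisClass_eq_finrank_traceField,
    ← natCard_block_mul_finrank_eq_finrank_traceField k₀ Φ]
  have hb : 0 < Nat.card {Ψ : CMType K // (∃ τ : ℂ ≃+* ℂ, Ψ = cmTypeSmul τ Φ) ∧
      (fun ψ : k₀ →+* ℂ => {φ : K →+* ℂ | φ ∈ Ψ.1 ∧ φ.comp (algebraMap k₀ K) = ψ}.ncard) =
        fun ψ => {φ : K →+* ℂ | φ ∈ Φ.1 ∧ φ.comp (algebraMap k₀ K) = ψ}.ncard} := by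
    rw [natCard_block_eq_relfinrank]
    exact Nat.pos_of_ne_zero fun h0 => (finrank_traceField_pos Φ).ne' (by
      rw [← IntermediateField.finrank_bot_mul_relfinrank (adjoin_cmTypeTrace_algebraMap_le_traceField k₀ Φ), h0, mul_zero])
  constructor
  · intro h
    exact (Nat.eq_of_mul_eq_mul_left hb (h.symm.trans (mul_one _).symm))
  · intro h
    rw [h, mul_one]

end Orbit

/-! ## §3 `k₀` imaginary quadratic: Dodson's `|G₀*(f)| = |G*(f)| / 2` (unbalanced) or `= |G*(f)|` (balanced) -/

section ImaginaryQuadratic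

variable [IsTotallyComplex k₀] (h2 : finrank ℚ k₀ = 2) (ψ₀ : k₀ →+* ℂ)
include h2

/-- **`k₀` imaginary quadratic, `m_{ψ₀} ≠ m_{ψ̄₀}` ⟹ `2 · #block = [K* : ℚ]`** (Dodson: the orbit `G*(f) = G₀*(f) ∪ G₀*(ρf)`
with `|G₀*(f)| = |G₀*(ρf)|`). [cite: Dodson1984, §3.1.1 Theorem (proof, p. 12)] -/
theorem two_mul_natCard_block_eq_of_ncard_ne
    (hne : {φ : K →+* ℂ | φ ∈ Φ.1 ∧ φ.comp (algebraMap k₀ K) = ψ₀}.ncard ≠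
      {φ : K →+* ℂ | φ ∈ Φ.1 ∧ φ.comp (algebraMap k₀ K) = ComplexEmbedding.conjugate ψ₀}.ncard) :
    2 * Nat.card {Ψ : CMType K // (∃ τ : ℂ ≃+* ℂ, Ψ = cmTypeSmul τ Φ) ∧
        (fun ψ : k₀ →+* ℂ => {φ : K →+* ℂ | φ ∈ Ψ.1 ∧ φ.comp (algebraMap k₀ K) = ψ}.ncard) =
          fun ψ => {φ : K →+* ℂ | φ ∈ Φ.1 ∧ φ.comp (algebraMap k₀ K) = ψ}.ncard} =
      Nat.card {Ψ : CMType K // ∃ τ : ℂ ≃+* ℂ, Ψ = cmTypeSmul τ Φ} := by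
  rw [mul_comm, ← finrank_adjoin_cmTypeTrace_algebraMap_eq_two_of_ncard_ne k₀ Φ h2 ψ₀ hne,
    natCard_block_mul_finrank_eq_finrank_traceField, natCard_galoisClass_eq_finrank_traceField]

/-- **`k₀` imaginary quadratic, `m_{ψ₀} = m_{ψ̄₀}` (balanced) ⟹ the block of `Φ` is the whole class.**
[cite: Dodson1984, §3.1.1 Theorem (proof, p. 12)] [cite: KudlaRapoport2013, §4.1 footnote] -/
theorem natCard_block_eq_of_ncard_eq
    (heq : {φ : K →+* ℂ | φ ∈ Φ.1 ∧ φ.comp (algebraMap k₀ K) = ψ₀}.ncard =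
      {φ : K →+* ℂ | φ ∈ Φ.1 ∧ φ.comp (algebraMap k₀ K) = ComplexEmbedding.conjugate ψ₀}.ncard) :
    Nat.card {Ψ : CMType K // (∃ τ : ℂ ≃+* ℂ, Ψ = cmTypeSmul τ Φ) ∧
        (fun ψ : k₀ →+* ℂ => {φ : K →+* ℂ | φ ∈ Ψ.1 ∧ φ.comp (algebraMap k₀ K) = ψ}.ncard) =
          fun ψ => {φ : K →+* ℂ | φ ∈ Φ.1 ∧ φ.comp (algebraMap k₀ K) = ψ}.ncard} =
      Nat.card {Ψ : CMType K // ∃ τ : ℂ ≃+* ℂ, Ψ = cmTypeSmul τ Φ} :=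
  (natCard_block_eq_natCard_galoisClass_iff k₀ Φ).2 ((adjoin_cmTypeTrace_algebraMap_eq_bot_iff_ncard_eq k₀ Φ h2 ψ₀).2 heq)

end ImaginaryQuadratic

end Literature.NumberTheory.ComplexMultiplication
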